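import Mathlib
import HarnessLib
import Summits.AtomisticToContinuum.Crystallization.Theorems.PricedLinkCensusSoftFourRingsThreeTriQuad
import Summits.AtomisticToContinuum.Crystallization.Theorems.PricedLinkCensusSoftFourRingsCapFacetCorner
import Summits.AtomisticToContinuum.Crystallization.Theorems.PricedLinkCensusSoftFourRingsFanGap

/-!
# The lone gap of a three-triangle fan is wider than any facet corner

Route `PricedLinkCensus`, item `SoftFourRings` (stmt-AtomisticToContinuum-14234), evidence
`softrings-search.md` §12.2.  At a site `v` whose four link neighbours `w₀ ∼ w₁ ∼ w₂ ∼ w₃` form a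
bonded path (three consecutive bond triangles), the three triangle corners are each `≤ g₁ = arccos K`
(`corner_cos_lower`, `K = (cb − ca²)/(1 − ca²)`, `71.9°` at `η = 1/100`) and the path winds
monotonically (`fin_four_path_dihedral`), so the remaining gap between `w₃` and `w₀` is
`≥ 2π − 3 g₁` (`144.3°`): the tangent directions at `v` towards `w₀` and `w₃` have cosine
`≤ cos (3 g₁) = 4K³ − 3K ≈ −0.812` (`four_sorted_fan_gap`, `four_fan_gap`, `three_fan_gap`).
Since every facet corner of the twelve directions has cosine `≥ −0.73` (`FacetCorner`, conditional
on Tammes-13), NO FACET of the hull contains `v`, `w₀` and `w₃` together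
(`no_facet_through_three_fan_one_percent`): the lone gap of a three-triangle vertex is crossed by a
further (non-bond) hull edge at `v`.

**`Cap` variant** (seat c3 of stmt-AtomisticToContinuum-14234): identical to `PricedLinkCensusSoftFourRingsFanGap`, except that the
global Tammes-13 hypothesis `(hT : musinTarasov2012_tammes_thirteen)` is replaced by the LOCAL covering
property of the twelve directions, `hT : ∀ p, ‖p‖ = 1 → ∃ x ∈ X, dist p x < 0.957` (no empty cap of
angular radius `57.18°`), which is all the two roots (`FacetCap`, `Interior`) ever used; the hT-free
lemmas are not repeated (the original file is imported for them).
-/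

namespace Summit.AtomisticToContinuum.Crystallization.Theorems.Cap

open Real RealInnerProductSpace Literature.Geometry.DiscreteGeometry

/-- **No facet through a three-triangle fan** (`η = 1/100`, conditional on Tammes-13).  For at
least twelve unit vectors `X` pairwise at inner product `≤ ca = 1 − 1/(2·(101/100)²)`, a site
`v ∈ X` with four link directions `w k ∈ X` in the window `cb = 1 − (101/100)²/2 ≤ ⟪v, w k⟫`,
pairwise separated and bonded along the path `w₀ ∼ w₁ ∼ w₂ ∼ w₃`, and a supporting functional
`c` (`⟪c, ·⟫ ≤ 1` on `X`): `v`, `w₀`, `w₃` are not all tight for `c` — the fan gap has cosine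
`≤ 4K³ − 3K < −0.81` while every facet corner has cosine `≥ −0.73`.
[cite: MusinTarasov2012, Theorem 1] -/
theorem no_facet_through_three_fan_one_percent {X : Finset (EuclideanSpace ℝ (Fin 3))}
    (hT : ∀ p : EuclideanSpace ℝ (Fin 3), ‖p‖ = 1 → ∃ x ∈ X, dist p x < 0.957)
    (hX1 : ∀ y ∈ X, ‖y‖ = 1) (hcard : 12 ≤ X.card)
    (hsepX : ∀ u ∈ X, ∀ u' ∈ X, u ≠ u' → ⟪u, u'⟫ ≤ 1 - 1 / (2 * (101 / 100 : ℝ) ^ 2))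
    {v : EuclideanSpace ℝ (Fin 3)} (hv : v ∈ X) (w : Fin 4 → EuclideanSpace ℝ (Fin 3))
    (hwX : ∀ k, w k ∈ X) (hwinj : Function.Injective w) (hwv : ∀ k, w k ≠ v)
    (hvw : ∀ k, 1 - (101 / 100 : ℝ) ^ 2 / 2 ≤ ⟪v, w k⟫)
    (h01 : 1 - (101 / 100 : ℝ) ^ 2 / 2 ≤ ⟪w 0, w 1⟫)
    (h12 : 1 - (101 / 100 : ℝ) ^ 2 / 2 ≤ ⟪w 1, w 2⟫)
    (h23 : 1 - (101 / 100 : ℝ) ^ 2 / 2 ≤ ⟪w 2, w 3⟫) {c : EuclideanSpace ℝ (Fin 3)}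
    (hc : ∀ y ∈ X, ⟪c, y⟫ ≤ 1) (hcv : ⟪c, v⟫ = 1) (hc0 : ⟪c, w 0⟫ = 1) (hc3 : ⟪c, w 3⟫ = 1) :
    False := by
  have hvn : ‖v‖ = 1 := hX1 v hv
  have hwin : ∀ k, 1 - (101 / 100 : ℝ) ^ 2 / 2 ≤ ⟪v, w k⟫ ∧
      ⟪v, w k⟫ ≤ 1 - 1 / (2 * (101 / 100 : ℝ) ^ 2) :=
    fun k => ⟨hvw k, hsepX v hv (w k) (hwX k) (hwv k).symm⟩
  have hsep : ∀ i j, i ≠ j → ⟪w i, w j⟫ ≤ 1 - 1 / (2 * (101 / 100 : ℝ) ^ 2) :=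
    fun i j hij => hsepX (w i) (hwX i) (w j) (hwX j) (fun h => hij (hwinj h))
  -- the fan gap: `cos ≤ 4K³ − 3K`
  have hgap := three_fan_gap (ca := 1 - 1 / (2 * (101 / 100 : ℝ) ^ 2))
    (cb := 1 - (101 / 100 : ℝ) ^ 2 / 2) (K := 478679849399 / 1540200000000) (by norm_num)
    (by norm_num) (by norm_num) (by norm_num) (by norm_num) (by norm_num) (by norm_num)
    (by norm_num) (by norm_num) hvn w (fun k => hX1 _ (hwX k)) hwin hsep h01 h12 h23
  -- the corner cap: `cos ≥ −0.73`
  have hcap := facet_corner_cos_ge_one_percent hT hX1 hcard hsepX hc hv (hwX 0) (hwX 3) (hwv 0)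
    (hwv 3) hcv hc0 hc3
  -- the tangent vectors are nonzero
  have hpos : ∀ k, 0 < ‖w k - ⟪v, w k⟫ • v‖ := by
    intro k
    have hvv : ⟪v, v⟫ = 1 := by rw [real_inner_self_eq_norm_sq, hvn]; norm_num
    have hkk : ⟪w k, w k⟫ = 1 := by rw [real_inner_self_eq_norm_sq, hX1 _ (hwX k)]; norm_num
    have h2 : ‖w k - ⟪v, w k⟫ • v‖ ^ 2 = 1 - ⟪v, w k⟫ ^ 2 := by
      rw [← real_inner_self_eq_norm_sq, inner_sub_left, inner_sub_right, inner_sub_right,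
        real_inner_smul_left, real_inner_smul_right, real_inner_smul_left, real_inner_smul_right,
        hvv, hkk, real_inner_comm (w k) v]
      ring
    have hlt : ⟪v, w k⟫ ^ 2 < 1 := by
      have := (hwin k).1
      have := (hwin k).2
      nlinarith
    have : 0 < ‖w k - ⟪v, w k⟫ • v‖ ^ 2 := by rw [h2]; linarith
    exact lt_of_le_of_ne (norm_nonneg _) (fun h => by rw [← h] at this; norm_num at this)
  have hprod := mul_pos (hpos 0) (hpos 3)
  norm_num at hgap hcap
  nlinarith [hgap, hcap, hprod]

end Summit.AtomisticToContinuum.Crystallization.Theorems.Cap
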